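import Literature.NumberTheory.EllipticCurves.BhargavaShankarBodyIntegral
import Literature.NumberTheory.EllipticCurves.BhargavaShankarBigStabilizers
import HarnessLib

/-!
# Bhargava–Shankar, Theorem 2.1 (= Theorem 1.6): the discharge

This file proves the named fact `bhargavaShankar_classCount` of `BinaryQuarticForms`:
for every `ε > 0` there is `C` with, for all `X ≥ 1`,
`|N(V_ℤ^{(0)}; X) − (4/135) ζ(2) X^{5/6}|, |N(V_ℤ^{(1)}; X) − (32/135) ζ(2) X^{5/6}|,`
`|N(V_ℤ^{(2)}; X) − (8/135) ζ(2) X^{5/6}| ≤ C X^{3/4+ε}` (`ζ(2) = π²/6`), where `N(S; X)` counts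
`GL₂(ℤ)`-classes of irreducible integral binary quartic forms in `S` of height `< X`
[BhargavaShankarAnnals2015, Thm 1.6, Thm 2.1].

The assembly follows §2 of the paper:
* the fundamental sets: the five cone pieces of `BhargavaShankarConeFamilies` as `Piece`s
  (`piece0`, `piece1B/C/D`, `piece2`), their sections `𝓛_X` are section sets
  (`isSectionSet_data*`) representing exactly the irreducible forms of the given real type and
  height `< X` (`repr_iff_data*`), with `|Stab_{SL₂^±(ℝ)}| = 8, 4, 8` (`nst_data*`, Lemma 2.2) and
  `vol(B₁) = (1/27) μ(G₀) · (8/5, 32/5, 8/5)`;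
* the orbit side of the unfolding (`BhargavaShankarUnfolding`): the weight of the orbit of `x₀` is
  `n μ(G₀)/|Stab_Γ(x₀)|` or `0` (`orbitWeight_eq`), `|Stab_Γ| ≥ 2`, and `> 2` only on the
  `≤ 32500 X^{2/3}` orbits of `BhargavaShankarBigStabilizers` (Lemma 2.4); hence
  `2Λ/(nμ(G₀)) ≤ N ≤ 2Λ/(nμ(G₀)) + 32500 X^{2/3}` (`classCount_bounds`);
* the integral side (`BhargavaShankarBodyIntegral`, with Lemma 2.3 through
  `reducible_uniform_bound`) and the bookkeeping of the powers of `X` (`type_asymptotic`);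
* type `2` from type `2+` by `f ↦ −f` (`gl2zClassCount_noRealRoots`).

Main result: `Literature.NumberTheory.EllipticCurves.bhargavaShankar_classCount_holds`.

## References

* M. Bhargava, A. Shankar, *Binary quartic forms having bounded invariants, and the boundedness
  of the average rank of elliptic curves*, Ann. of Math. (2) 181 (2015) 191–242, Theorem 1.6 =
  Theorem 2.1, proof in §2 (§2.1 reduction theory, Lemma 2.2, §2.3 averaging and (17), §2.4
  (18)–(22)); arXiv:1006.1002v2 numbering. [cite: BhargavaShankarAnnals2015, Thm 1.6, Thm 2.1 and §2 (arXiv:1006.1002v2 numbering)]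
-/

noncomputable section

open Real MeasureTheory Matrix Set Filter Topology
open scoped MatrixGroups Pointwise ENNReal UpperHalfPlane

namespace Literature.NumberTheory.EllipticCurves

namespace BinaryQuartic

open Literature.MeasureTheory.Group Literature.Algebra.EuclideanLattices

attribute [local instance] Literature.MeasureTheory.Group.fact_two_pi_pos

/-! ## The five pieces of the fundamental sets as `Piece`s -/

/-- Coefficients of the `q`-curves are `≤ 1`. [folklore] -/
theorem abs_coeffs_qcurve_le {p q : ℝ} (hp : |p| ≤ 1) (hq : |q| ≤ 1) (l : Fin 5) :
    |(⟨0, 1, 0, p, q⟩ : BinaryQuartic ℝ).coeffs l| ≤ 1 := by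
  fin_cases l <;> simp [coeffs, hp, hq]

/-- The type-`0` piece: `q_{1,τ}`, `τ ∈ (−2, 2)`. [cite: BhargavaShankarAnnals2015, §2.1 (L_V^{(0)}; arXiv:1006.1002v2 numbering)] -/
def piece0 : Piece where
  C := curve0
  t₁ := -2
  t₂ := 2
  T := Set.Ioo (-2) 2
  ht := by norm_num
  ht4 := by norm_num
  hT₁ := subset_rfl
  hT₂ := Set.Ioo_subset_Icc_self
  hTm := measurableSet_Ioo
  hι := fun τ _ => by rw [iota_curve0]; norm_num
  hcoef := fun τ hτ l => by
    have h1 : |(-1 / 3 : ℝ)| ≤ 1 := by norm_num [abs_div]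
    have h2 : |(-τ / 27 : ℝ)| ≤ 1 := by
      rw [abs_div, abs_neg]; have := abs_lt.2 ⟨hτ.1, hτ.2⟩
      rw [div_le_one (by norm_num)]; norm_num at this ⊢; linarith [this.le]
    exact abs_coeffs_qcurve_le h1 h2 l
  hΔ := fun τ hτ => by
    rw [disc_curve0]; have : τ ^ 2 < 4 := by nlinarith [hτ.1, hτ.2]
    intro h; linarith
  huniq := fun m m' τ τ' hm hm' _ _ hI hJ => cone0_params_unique hm hm' hI hJ

/-- The type-`1` piece `B`: `q_{−1,τ}`, `τ ∈ [−2, 2]`. [cite: BhargavaShankarAnnals2015, §2.1 (L_V^{(1)}; arXiv:1006.1002v2 numbering)] -/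
def piece1B : Piece where
  C := curve1B
  t₁ := -2
  t₂ := 2
  T := Set.Icc (-2) 2
  ht := by norm_num
  ht4 := by norm_num
  hT₁ := Set.Ioo_subset_Icc_self
  hT₂ := subset_rfl
  hTm := measurableSet_Icc
  hι := fun τ _ => by rw [iota_curve1B]; norm_num
  hcoef := fun τ hτ l => by
    have h1 : |(1 / 3 : ℝ)| ≤ 1 := by norm_num [abs_div]
    have h2 : |(-τ / 27 : ℝ)| ≤ 1 := by
      rw [abs_div, abs_neg]; have := abs_le.2 ⟨hτ.1, hτ.2⟩
      rw [div_le_one (by norm_num)]; norm_num at this ⊢; linarith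
    exact abs_coeffs_qcurve_le h1 h2 l
  hΔ := fun τ _ => by
    rw [disc_curve1B]; have : 0 ≤ τ ^ 2 := sq_nonneg τ
    intro h; linarith
  huniq := fun m m' τ τ' hm hm' _ _ hI hJ => cone1B_params_unique hm hm' hI hJ

/-- `τ³ < 1` for `τ < 1`. [folklore] -/
theorem cube_lt_one {τ : ℝ} (hτ : τ < 1) : τ ^ 3 < 1 := by
  rcases le_or_gt 0 τ with h0 | h0
  · calc τ ^ 3 < 1 ^ 3 := pow_lt_pow_left₀ hτ h0 (by norm_num)
      _ = 1 := by norm_num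
  · have : τ ^ 3 < 0 := by
      have e : τ ^ 3 = τ * τ ^ 2 := by ring
      rw [e]; exact mul_neg_of_neg_of_pos h0 (lt_of_le_of_ne (sq_nonneg τ) (Ne.symm (pow_ne_zero 2 h0.ne)))
    linarith

/-- The type-`1` piece `C`: `q_{τ,2}`, `τ ∈ (−1, 1)`. [cite: BhargavaShankarAnnals2015, §2.1 (L_V^{(1)}; arXiv:1006.1002v2 numbering)] -/
def piece1C : Piece where
  C := curve1C
  t₁ := -1
  t₂ := 1
  T := Set.Ioo (-1) 1
  ht := by norm_num
  ht4 := by norm_num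
  hT₁ := subset_rfl
  hT₂ := Set.Ioo_subset_Icc_self
  hTm := measurableSet_Ioo
  hι := fun τ _ => by rw [iota_curve1C]; norm_num
  hcoef := fun τ hτ l => by
    have h1 : |(-τ / 3 : ℝ)| ≤ 1 := by
      rw [abs_div, abs_neg]; have := abs_lt.2 ⟨hτ.1, hτ.2⟩
      rw [div_le_one (by norm_num)]; norm_num at this ⊢; linarith [this.le]
    have h2 : |(-2 / 27 : ℝ)| ≤ 1 := by norm_num [abs_div]
    exact abs_coeffs_qcurve_le h1 h2 l
  hΔ := fun τ hτ => by
    rw [disc_curve1C]; have := cube_lt_one hτ.2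
    intro h; linarith
  huniq := fun m m' τ τ' hm hm' _ _ hI hJ => cone1C_params_unique hm hm' hI hJ

/-- The type-`1` piece `D`: `q_{τ,−2}`, `τ ∈ (−1, 1)`. [cite: BhargavaShankarAnnals2015, §2.1 (L_V^{(1)}; arXiv:1006.1002v2 numbering)] -/
def piece1D : Piece where
  C := curve1D
  t₁ := -1
  t₂ := 1
  T := Set.Ioo (-1) 1
  ht := by norm_num
  ht4 := by norm_num
  hT₁ := subset_rfl
  hT₂ := Set.Ioo_subset_Icc_self
  hTm := measurableSet_Ioo
  hι := fun τ _ => by rw [iota_curve1D]; norm_num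
  hcoef := fun τ hτ l => by
    have h1 : |(-τ / 3 : ℝ)| ≤ 1 := by
      rw [abs_div, abs_neg]; have := abs_lt.2 ⟨hτ.1, hτ.2⟩
      rw [div_le_one (by norm_num)]; norm_num at this ⊢; linarith [this.le]
    have h2 : |(2 / 27 : ℝ)| ≤ 1 := by norm_num [abs_div]
    exact abs_coeffs_qcurve_le h1 h2 l
  hΔ := fun τ hτ => by
    rw [disc_curve1D]; have := cube_lt_one hτ.2
    intro h; linarith
  huniq := fun m m' τ τ' hm hm' _ _ hI hJ => cone1D_params_unique hm hm' hI hJ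

/-- `r(s) ≤ 1` and `|r(s) s| ≤ 1`. [folklore] -/
theorem rad2_le_one (s : ℝ) : rad2 s ≤ 1 ∧ |rad2 s * s| ≤ 1 := by
  have hr := rad2_pos s
  have hsq := rad2_sq_mul s
  have h1 : rad2 s ^ 2 ≤ 1 := by nlinarith [sq_nonneg s]
  have h2 : (rad2 s * s) ^ 2 ≤ 1 := by nlinarith [sq_nonneg s]
  constructor
  · nlinarith
  · rw [← abs_one]; exact sq_le_sq.1 (by simpa using h2)

/-- The type-`2+` piece: `(12 + s²)^{-1/2}(x⁴ + s x²y² + y⁴)`, `s ∈ (−2, 2)`. [cite: BhargavaShankarAnnals2015, §2.1 (L_V^{(2+)}; arXiv:1006.1002v2 numbering)] -/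
def piece2 : Piece where
  C := curve2
  t₁ := -2
  t₂ := 2
  T := Set.Ioo (-2) 2
  ht := by norm_num
  ht4 := by norm_num
  hT₁ := subset_rfl
  hT₂ := Set.Ioo_subset_Icc_self
  hTm := measurableSet_Ioo
  hι := fun s hs => by
    rw [iota_curve2]
    have hr := rad2_pos s
    have h4 : 0 < 4 - s ^ 2 := by nlinarith [hs.1, hs.2]
    positivity
  hcoef := fun s _ l => by
    obtain ⟨h1, h2⟩ := rad2_le_one s
    have hr := rad2_pos s
    have h1' : |rad2 s| ≤ 1 := by rw [abs_of_pos hr]; exact h1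
    have h2' : |rad2 s| * |s| ≤ 1 := by rwa [abs_mul] at h2
    fin_cases l <;> simp [coeffs, curve2, h1', h2']
  hΔ := fun s hs => (disc_curve2_pos hs).ne'
  huniq := fun m m' s s' hm hm' hs hs' hI hJ =>
    cone2_params_unique hm hm' ⟨hs.1.le, hs.2.le⟩ ⟨hs'.1.le, hs'.2.le⟩ hI hJ

/-- The data for type `0`. [folklore] -/
def data0 : Fin 1 → Piece := ![piece0]

/-- The data for type `1`. [folklore] -/
def data1 : Fin 3 → Piece := ![piece1B, piece1C, piece1D]

/-- The data for type `2+`. [folklore] -/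
def data2 : Fin 1 → Piece := ![piece2]

/-! ## The sections are section sets -/

/-- Forms of the sections have nonzero discriminant. [folklore] -/
theorem disc_ne_of_mem_sections {K : ℕ} (D : Fin K → Piece) {X : ℝ} {ℓ : BinaryQuartic ℝ} (hℓ : ℓ ∈ sections D X) :
    ℓ.disc ≠ 0 := by
  obtain ⟨k, m, τ, hm, -, hτ, rfl⟩ := hℓ
  rw [disc_smul_real]
  exact mul_ne_zero (pow_ne_zero 6 hm.ne') ((D k).hΔ τ hτ)

/-- Sections over a single piece form a section set. [folklore] -/
theorem isSectionSet_of_one (P : Piece) (X : ℝ) : IsSectionSet (sections ![P] X) := by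
  refine ⟨fun ℓ hℓ => disc_ne_of_mem_sections _ hℓ, ?_⟩
  rintro ℓ ⟨k, m, τ, hm, -, hτ, rfl⟩ ℓ' ⟨k', m', τ', hm', -, hτ', rfl⟩ hI hJ
  fin_cases k; fin_cases k'
  simp only [Fin.zero_eta, Fin.isValue, Matrix.cons_val_zero] at *
  obtain ⟨rfl, rfl⟩ := P.huniq m m' τ τ' hm hm' hτ hτ' hI hJ
  rfl

/-- `isSectionSet_data0` (auxiliary). [folklore] -/
theorem isSectionSet_data0 (X : ℝ) : IsSectionSet (sections data0 X) := isSectionSet_of_one _ X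

/-- `isSectionSet_data2` (auxiliary). [folklore] -/
theorem isSectionSet_data2 (X : ℝ) : IsSectionSet (sections data2 X) := isSectionSet_of_one _ X

/-- The three type-`1` pieces are separated by their invariants. [folklore] -/
theorem isSectionSet_data1 (X : ℝ) : IsSectionSet (sections data1 X) := by
  refine ⟨fun ℓ hℓ => disc_ne_of_mem_sections _ hℓ, ?_⟩
  rintro ℓ ⟨k, m, τ, hm, -, hτ, rfl⟩ ℓ' ⟨k', m', τ', hm', -, hτ', rfl⟩ hI hJ
  fin_cases k <;> fin_cases k' <;>
    simp only [data1, piece1B, piece1C, piece1D, Fin.zero_eta, Fin.mk_one, Fin.reduceFinMk, Fin.isValue,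
      Matrix.cons_val_zero, Matrix.cons_val_one, Matrix.cons_val] at hτ hτ' hI hJ ⊢
  · obtain ⟨rfl, rfl⟩ := cone1B_params_unique hm hm' hI hJ; rfl
  · exfalso
    have h1 := cone1B_invariants m (τ := τ) hτ
    have h2 := (cone1C_invariants hm' (τ := τ') hτ').1
    rw [hI, hJ] at h1; linarith
  · exfalso
    have h1 := cone1B_invariants m (τ := τ) hτ
    have h2 := (cone1D_invariants hm' (τ := τ') hτ').1
    rw [hI, hJ] at h1; linarith
  · exfalso
    have h1 := cone1B_invariants m' (τ := τ') hτ'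
    have h2 := (cone1C_invariants hm (τ := τ) hτ).1
    rw [← hI, ← hJ] at h1; linarith
  · obtain ⟨rfl, rfl⟩ := cone1C_params_unique hm hm' hI hJ; rfl
  · exfalso
    have h1 := (cone1C_invariants hm (τ := τ) hτ).2
    have h2 := (cone1D_invariants hm' (τ := τ') hτ').2
    rw [hJ] at h1; linarith
  · exfalso
    have h1 := cone1B_invariants m' (τ := τ') hτ'
    have h2 := (cone1D_invariants hm (τ := τ) hτ).1
    rw [← hI, ← hJ] at h1; linarith
  · exfalso
    have h1 := (cone1D_invariants hm (τ := τ) hτ).2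
    have h2 := (cone1C_invariants hm' (τ := τ') hτ').2
    rw [hJ] at h1; linarith
  · obtain ⟨rfl, rfl⟩ := cone1D_params_unique hm hm' hI hJ; rfl

/-! ## Heights, discriminants and types of the forms counted -/

/-- A piece together with the values of its curve: height `1` and a real-type property preserved
under `SL₂^±(ℝ)`. [folklore] -/
theorem height_eq_realHeightIJ (x : BinaryQuartic ℤ) :
    x.height = realHeightIJ (x.map (Int.castRingHom ℝ)).I (x.map (Int.castRingHom ℝ)).J := by
  simp [height, heightIJ, realHeightIJ, I_map, J_map]

/-- Height of a cone point after an `SL₂^±(ℝ)` substitution: `H((m·c) ∘ g) = m⁶ H(c)`. [folklore] -/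
theorem realHeightIJ_cone_subst (c : BinaryQuartic ℝ) (m : ℝ) {g : Matrix (Fin 2) (Fin 2) ℝ}
    (hg : g.det = 1 ∨ g.det = -1) :
    realHeightIJ ((m • c).subst g).I ((m • c).subst g).J = m ^ 6 * realHeightIJ c.I c.J := by
  rw [I_subst_of_det hg, J_subst_of_det hg, I_smul, J_smul, realHeightIJ_scale]

/-- `m < X^{1/6} ↔ m⁶ < X` for `m > 0`, `X > 0`. [folklore] -/
theorem lt_rpow_sixth_iff {m X : ℝ} (hm : 0 < m) (hX : 0 < X) : m < X ^ (1 / 6 : ℝ) ↔ m ^ 6 < X := by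
  have h6 : (X ^ (1 / 6 : ℝ)) ^ 6 = X := by
    rw [← Real.rpow_natCast, ← Real.rpow_mul hX.le]; norm_num
  constructor
  · intro h
    calc m ^ 6 < (X ^ (1 / 6 : ℝ)) ^ 6 := pow_lt_pow_left₀ h hm.le (by norm_num)
      _ = X := h6
  · intro h
    by_contra hle; push Not at hle
    have : (X ^ (1 / 6 : ℝ)) ^ 6 ≤ m ^ 6 := pow_le_pow_left₀ (Real.rpow_nonneg hX.le _) hle 6
    linarith

/-- Scaling by `m ≠ 0` preserves definiteness. [folklore] -/
theorem isDefinite_smul_iff {m : ℝ} (hm : 0 < m) (f : BinaryQuartic ℝ) : (m • f).IsDefinite ↔ f.IsDefinite := by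
  simp only [IsDefinite, eval_smul]
  constructor
  · rintro (h | h)
    · left; intro x y hxy; have := h x y hxy; nlinarith [this]
    · right; intro x y hxy; have := h x y hxy; nlinarith [this]
  · rintro (h | h)
    · left; intro x y hxy; exact mul_pos hm (h x y hxy)
    · right; intro x y hxy; exact mul_neg_of_pos_of_neg hm (h x y hxy)

/-- **The forms represented by the type-`0` sections are exactly the forms with four real roots
of height `< X`** (among forms with `Δ ≠ 0`). [cite: BhargavaShankarAnnals2015, §2.1 (L_V^{(0)} is a fundamental set) and §2.3; arXiv:1006.1002v2 numbering] -/
theorem repr_iff_data0 {x : BinaryQuartic ℤ} (hΔ : x.disc ≠ 0) {X : ℝ} (hX : 0 < X) :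
    (∃ ℓ₀ ∈ sections data0 X, ∃ g₀ : Matrix (Fin 2) (Fin 2) ℝ, (g₀.det = 1 ∨ g₀.det = -1) ∧
        x.map (Int.castRingHom ℝ) = ℓ₀.subst g₀) ↔ (x ∈ fourRealRoots ∧ x.height < X) := by
  have hΔR : (x.map (Int.castRingHom ℝ)).disc ≠ 0 := by rw [disc_map, eq_intCast]; exact_mod_cast hΔ
  constructor
  · rintro ⟨ℓ₀, ⟨k, m, τ, hm, hmX, hτ, rfl⟩, g₀, hg₀, hx⟩
    fin_cases k
    simp only [data0, piece0, Fin.zero_eta, Fin.isValue, Matrix.cons_val_zero] at hτ hx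
    have hdetne : g₀.det ≠ 0 := by rcases hg₀ with h | h <;> rw [h] <;> norm_num
    refine ⟨⟨?_, ?_⟩, ?_⟩
    · -- `Δ > 0`
      have h1 : (x.map (Int.castRingHom ℝ)).disc = ((m • curve0.c τ).subst g₀).disc := by rw [hx]
      rw [disc_map, eq_intCast, disc_subst, disc_smul_real, disc_curve0] at h1
      have h12 : g₀.det ^ 12 = 1 := by rcases hg₀ with h | h <;> rw [h] <;> norm_num
      rw [h12, one_mul] at h1
      have : (0 : ℝ) < m ^ 6 * ((4 - τ ^ 2) / 27) := by
        have : τ ^ 2 < 4 := by nlinarith [hτ.1, hτ.2]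
        have : 0 < (4 - τ ^ 2) / 27 := by linarith
        positivity
      rw [← h1] at this; exact_mod_cast this
    · rw [hx, isDefinite_subst_iff _ hdetne]; exact not_isDefinite_cone0 m τ
    · rw [height_eq_realHeightIJ, hx, realHeightIJ_cone_subst _ _ hg₀, realHeightIJ_curve0 (abs_le.2 ⟨hτ.1.le, hτ.2.le⟩),
        mul_one]
      exact (lt_rpow_sixth_iff hm hX).1 hmX
  · rintro ⟨⟨hpos, hnd⟩, hH⟩
    have hposR : 0 < (x.map (Int.castRingHom ℝ)).disc := by rw [disc_map, eq_intCast]; exact_mod_cast hpos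
    obtain ⟨m, τ, hm, hτ, γ, hγ, hx⟩ := exists_cone0_subst hposR hnd
    have hm6 : m ^ 6 < X := by
      rw [height_eq_realHeightIJ, hx, realHeightIJ_cone_subst _ _ hγ, realHeightIJ_curve0 (abs_le.2 ⟨hτ.1.le, hτ.2.le⟩),
        mul_one] at hH
      exact hH
    exact ⟨m • curve0.c τ, ⟨0, m, τ, hm, (lt_rpow_sixth_iff hm hX).2 hm6, hτ, rfl⟩, γ, hγ, hx⟩

/-- **The forms represented by the type-`1` sections are exactly the forms with two real roots of
height `< X`**. [cite: BhargavaShankarAnnals2015, §2.1 and §2.3 (arXiv:1006.1002v2 numbering)] -/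
theorem repr_iff_data1 {x : BinaryQuartic ℤ} {X : ℝ} (hX : 0 < X) :
    (∃ ℓ₀ ∈ sections data1 X, ∃ g₀ : Matrix (Fin 2) (Fin 2) ℝ, (g₀.det = 1 ∨ g₀.det = -1) ∧
        x.map (Int.castRingHom ℝ) = ℓ₀.subst g₀) ↔ (x ∈ twoRealRoots ∧ x.height < X) := by
  constructor
  · rintro ⟨ℓ₀, ⟨k, m, τ, hm, hmX, hτ, rfl⟩, g₀, hg₀, hx⟩
    have h12 : g₀.det ^ 12 = 1 := by rcases hg₀ with h | h <;> rw [h] <;> norm_num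
    have h1 : (x.map (Int.castRingHom ℝ)).disc = ((m • (data1 k).C.c τ).subst g₀).disc := by rw [hx]
    rw [disc_map, eq_intCast, disc_subst, disc_smul_real, h12, one_mul] at h1
    have hH : x.height = m ^ 6 * realHeightIJ ((data1 k).C.c τ).I ((data1 k).C.c τ).J := by
      rw [height_eq_realHeightIJ, hx, realHeightIJ_cone_subst _ _ hg₀]
    fin_cases k <;>
      simp only [data1, piece1B, piece1C, piece1D, Fin.zero_eta, Fin.mk_one, Fin.reduceFinMk, Fin.isValue,
        Matrix.cons_val_zero, Matrix.cons_val_one, Matrix.cons_val] at hτ h1 hH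
    · refine ⟨?_, ?_⟩
      · rw [disc_curve1B] at h1
        have : m ^ 6 * ((-4 - τ ^ 2) / 27) < 0 := by
          have : (-4 - τ ^ 2) / 27 < 0 := by nlinarith [sq_nonneg τ]
          exact mul_neg_of_pos_of_neg (by positivity) this
        rw [← h1] at this
        have : ((x.disc : ℤ) : ℝ) < 0 := this
        exact_mod_cast this
      · rw [hH, realHeightIJ_curve1B (abs_le.2 ⟨hτ.1, hτ.2⟩), mul_one]; exact (lt_rpow_sixth_iff hm hX).1 hmX
    · refine ⟨?_, ?_⟩
      · rw [disc_curve1C] at h1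
        have : m ^ 6 * ((4 * τ ^ 3 - 4) / 27) < 0 := by
          have := cube_lt_one hτ.2
          have : (4 * τ ^ 3 - 4) / 27 < 0 := by linarith
          exact mul_neg_of_pos_of_neg (by positivity) this
        rw [← h1] at this
        have : ((x.disc : ℤ) : ℝ) < 0 := this
        exact_mod_cast this
      · rw [hH, realHeightIJ_curve1C (abs_le.2 ⟨hτ.1.le, hτ.2.le⟩), mul_one]; exact (lt_rpow_sixth_iff hm hX).1 hmX
    · refine ⟨?_, ?_⟩
      · rw [disc_curve1D] at h1
        have : m ^ 6 * ((4 * τ ^ 3 - 4) / 27) < 0 := by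
          have := cube_lt_one hτ.2
          have : (4 * τ ^ 3 - 4) / 27 < 0 := by linarith
          exact mul_neg_of_pos_of_neg (by positivity) this
        rw [← h1] at this
        have : ((x.disc : ℤ) : ℝ) < 0 := this
        exact_mod_cast this
      · rw [hH, realHeightIJ_curve1D (abs_le.2 ⟨hτ.1.le, hτ.2.le⟩), mul_one]; exact (lt_rpow_sixth_iff hm hX).1 hmX
  · rintro ⟨hneg, hH⟩
    have hnegR : (x.map (Int.castRingHom ℝ)).disc < 0 := by
      rw [disc_map, eq_intCast]; have : x.disc < 0 := hneg; exact_mod_cast this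
    rw [height_eq_realHeightIJ] at hH
    rcases exists_cone1_subst hnegR with ⟨m, τ, hm, hτ, γ, hγ, hx⟩ | ⟨m, τ, hm, hτ, γ, hγ, hx⟩ | ⟨m, τ, hm, hτ, γ, hγ, hx⟩
    · rw [hx, realHeightIJ_cone_subst _ _ hγ, realHeightIJ_curve1B (abs_le.2 ⟨hτ.1, hτ.2⟩), mul_one] at hH
      exact ⟨_, ⟨0, m, τ, hm, (lt_rpow_sixth_iff hm hX).2 hH, hτ, rfl⟩, γ, hγ, hx⟩
    · rw [hx, realHeightIJ_cone_subst _ _ hγ, realHeightIJ_curve1C (abs_le.2 ⟨hτ.1.le, hτ.2.le⟩), mul_one] at hH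
      exact ⟨_, ⟨1, m, τ, hm, (lt_rpow_sixth_iff hm hX).2 hH, hτ, rfl⟩, γ, hγ, hx⟩
    · rw [hx, realHeightIJ_cone_subst _ _ hγ, realHeightIJ_curve1D (abs_le.2 ⟨hτ.1.le, hτ.2.le⟩), mul_one] at hH
      exact ⟨_, ⟨2, m, τ, hm, (lt_rpow_sixth_iff hm hX).2 hH, hτ, rfl⟩, γ, hγ, hx⟩

/-- Positivity at one nonzero vector plus definiteness gives positive definiteness. [folklore] -/
theorem posDef_of_isDefinite_of_pos {f : BinaryQuartic ℝ} (hd : f.IsDefinite) {u v : ℝ} (huv : u ≠ 0 ∨ v ≠ 0)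
    (hpos : 0 < f.eval u v) : ∀ x y : ℝ, (x ≠ 0 ∨ y ≠ 0) → 0 < f.eval x y := by
  rcases hd with h | h
  · exact h
  · exact absurd (h u v huv) (not_lt.2 hpos.le)

/-- **The forms represented by the type-`2+` sections are exactly the positive definite forms of
height `< X`** (among forms with `Δ ≠ 0`). [cite: BhargavaShankarAnnals2015, §2.1 and §2.3 (arXiv:1006.1002v2 numbering)] -/
theorem repr_iff_data2 {x : BinaryQuartic ℤ} (hΔ : x.disc ≠ 0) {X : ℝ} (hX : 0 < X) :
    (∃ ℓ₀ ∈ sections data2 X, ∃ g₀ : Matrix (Fin 2) (Fin 2) ℝ, (g₀.det = 1 ∨ g₀.det = -1) ∧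
        x.map (Int.castRingHom ℝ) = ℓ₀.subst g₀) ↔ (x ∈ posDefinite ∧ x.height < X) := by
  have hΔR : (x.map (Int.castRingHom ℝ)).disc ≠ 0 := by rw [disc_map, eq_intCast]; exact_mod_cast hΔ
  constructor
  · rintro ⟨ℓ₀, ⟨k, m, s, hm, hmX, hs, rfl⟩, g₀, hg₀, hx⟩
    fin_cases k
    simp only [data2, piece2, Fin.zero_eta, Fin.isValue, Matrix.cons_val_zero] at hs hx
    have hdetne : g₀.det ≠ 0 := by rcases hg₀ with h | h <;> rw [h] <;> norm_num
    refine ⟨?_, ?_⟩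
    · -- positive definite
      have hpd : ∀ u v : ℝ, (u ≠ 0 ∨ v ≠ 0) → 0 < (m • curve2.c s).eval u v := eval_cone2_pos hm hs.1
      have hdef : (x.map (Int.castRingHom ℝ)).IsDefinite := by
        rw [hx, isDefinite_subst_iff _ hdetne]; exact Or.inl hpd
      -- value at `(1, 0)` of `x_ℝ`: `= (m c) (g₀₀₀, g₀₀₁) > 0`
      have hrow : g₀ 0 0 ≠ 0 ∨ g₀ 0 1 ≠ 0 := by
        by_contra hcon; push Not at hcon
        apply hdetne; rw [Matrix.det_fin_two, hcon.1, hcon.2]; ring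
      have hval : 0 < (x.map (Int.castRingHom ℝ)).eval 1 0 := by
        rw [hx, eval_subst]; simp only [one_mul, zero_mul, add_zero]; exact hpd _ _ hrow
      intro u v huv
      exact posDef_of_isDefinite_of_pos hdef (Or.inl one_ne_zero) hval u v huv
    · rw [height_eq_realHeightIJ, hx, realHeightIJ_cone_subst _ _ hg₀, realHeightIJ_curve2 ⟨hs.1.le, hs.2.le⟩, mul_one]
      exact (lt_rpow_sixth_iff hm hX).1 hmX
  · rintro ⟨hpd, hH⟩
    obtain ⟨m, s, hm, hs, γ, hγ, hx⟩ := exists_cone2_subst hΔR hpd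
    have hm6 : m ^ 6 < X := by
      rw [height_eq_realHeightIJ, hx, realHeightIJ_cone_subst _ _ (Or.inl hγ), realHeightIJ_curve2 ⟨hs.1.le, hs.2.le⟩,
        mul_one] at hH
      exact hH
    exact ⟨m • curve2.c s, ⟨0, m, s, hm, (lt_rpow_sixth_iff hm hX).2 hm6, hs, rfl⟩, γ, Or.inl hγ, hx⟩

/-! ## The stabilizers in `GL₂(ℤ)` -/

/-- The real matrix of `γ ∈ GL₂(ℤ)` determines `γ`. [folklore] -/
theorem gl2zGL_ext {γ γ' : gl2zGL} (h : ((γ : GL (Fin 2) ℝ) : Matrix (Fin 2) (Fin 2) ℝ) = ((γ' : GL (Fin 2) ℝ) : Matrix (Fin 2) (Fin 2) ℝ)) :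
    γ = γ' :=
  Subtype.ext (Units.ext h)

/-- The element `−1 ∈ GL₂(ℤ)`. [folklore] -/
def negOne : gl2zGL := ofIntGL (-1)

/-- The cast of `−1`. [folklore] -/
theorem map_cast_neg_one : ((-1 : Matrix (Fin 2) (Fin 2) ℤ)).map (Int.castRingHom ℝ) = -1 := by
  ext i j; fin_cases i <;> fin_cases j <;> simp

/-- `coe_coe_negOne` (auxiliary). [folklore] -/
theorem coe_coe_negOne : (((negOne : gl2zGL) : GL (Fin 2) ℝ) : Matrix (Fin 2) (Fin 2) ℝ) = -1 := by
  show ((Matrix.GeneralLinearGroup.map (Int.castRingHom ℝ) (-1 : GL (Fin 2) ℤ) : GL (Fin 2) ℝ) : Matrix (Fin 2) (Fin 2) ℝ) = -1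
  rw [coe_map_eq, Units.val_neg, Units.val_one, map_cast_neg_one]

/-- `negOne_ne_one` (auxiliary). [folklore] -/
theorem negOne_ne_one : (negOne : gl2zGL) ≠ 1 := by
  intro h
  have h1 := congrArg (fun γ : gl2zGL => ((γ : GL (Fin 2) ℝ) : Matrix (Fin 2) (Fin 2) ℝ) 0 0) h
  simp only [coe_coe_negOne] at h1
  norm_num at h1

/-- `−1` fixes every form. [folklore] -/
theorem negOne_smul (x : BinaryQuartic ℤ) : (negOne : gl2zGL) • x = x := by
  rw [gl2z_smul_def, negOne, intGL_ofIntGL, Units.val_neg, Units.val_one, subst_neg_matrix, subst_one]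

/-- The stabilizer in `GL₂(ℤ)` of an irreducible form embeds into the real stabilizer, hence is
finite. [folklore] -/
theorem finite_stabilizer {x : BinaryQuartic ℤ} (hx : x.IsIrreducible) :
    ((MulAction.stabilizer gl2zGL x : Set gl2zGL)).Finite := by
  have hΔ : (x.map (Int.castRingHom ℝ)).disc ≠ 0 := by
    rw [disc_map, eq_intCast]; exact_mod_cast disc_ne_zero_of_isIrreducible hx
  have hfin := finite_substStabilizer hΔ
  refine Set.Finite.of_finite_image (hfin.subset ?_) (f := fun γ : gl2zGL => ((γ : GL (Fin 2) ℝ) : Matrix (Fin 2) (Fin 2) ℝ))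
    (fun γ _ γ' _ h => gl2zGL_ext h)
  rintro _ ⟨γ, hγ, rfl⟩
  have hγ' : γ • x = x := hγ
  show (x.map (Int.castRingHom ℝ)).subst ((γ : GL (Fin 2) ℝ) : Matrix (Fin 2) (Fin 2) ℝ) = x.map (Int.castRingHom ℝ)
  rw [← map_gl2z_smul, hγ']

/-- `1` and `−1` are two distinct stabilizer elements: `|Stab_Γ(x)| ≥ 2`. [folklore] -/
theorem two_le_ncard_stabilizer {x : BinaryQuartic ℤ} (hx : x.IsIrreducible) :
    2 ≤ ((MulAction.stabilizer gl2zGL x : Set gl2zGL)).ncard := by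
  have h1 : (1 : gl2zGL) ∈ (MulAction.stabilizer gl2zGL x : Set gl2zGL) := (MulAction.stabilizer gl2zGL x).one_mem
  have h2 : (negOne : gl2zGL) ∈ (MulAction.stabilizer gl2zGL x : Set gl2zGL) := negOne_smul x
  calc 2 = ({(1 : gl2zGL), negOne} : Set gl2zGL).ncard := (Set.ncard_pair negOne_ne_one.symm).symm
    _ ≤ _ := Set.ncard_le_ncard (by intro γ hγ; rcases hγ with rfl | rfl <;> assumption) (finite_stabilizer hx)

/-- **A stabilizer of size `> 2` yields an integral stabilizer element `≠ ±1`**, so the orbit is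
one of those counted in `ncard_bigStab_orbits_le`. [folklore] -/
theorem exists_subst_eq_of_two_lt {x : BinaryQuartic ℤ} (hx : x.IsIrreducible)
    (h : 2 < ((MulAction.stabilizer gl2zGL x : Set gl2zGL)).ncard) :
    ∃ γ : Matrix (Fin 2) (Fin 2) ℤ, IsUnit γ.det ∧ γ ≠ 1 ∧ γ ≠ -1 ∧ x.subst γ = x := by
  obtain ⟨a, ha, b, hb, c, hc, hab, hac, hbc⟩ := (Set.two_lt_ncard (finite_stabilizer hx)).1 h
  -- one of `a, b, c` differs from both `1` and `negOne`
  have key : ∃ γ ∈ (MulAction.stabilizer gl2zGL x : Set gl2zGL), γ ≠ 1 ∧ γ ≠ negOne := by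
    by_cases ha1 : a = 1
    · by_cases hb2 : b = negOne
      · refine ⟨c, hc, ?_, ?_⟩ <;> rintro rfl
        · exact hac (ha1.trans rfl) |>.elim
        · exact hbc hb2
      · refine ⟨b, hb, fun hb1 => hab (ha1.trans hb1.symm), hb2⟩
    · by_cases ha2 : a = negOne
      · by_cases hb1 : b = 1
        · refine ⟨c, hc, ?_, ?_⟩ <;> rintro rfl
          · exact hbc hb1
          · exact hac ha2
        · refine ⟨b, hb, hb1, fun hb2 => hab (ha2.trans hb2.symm)⟩
      · exact ⟨a, ha, ha1, ha2⟩
  obtain ⟨γ, hγ, hγ1, hγ2⟩ := key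
  refine ⟨((intGL γ : GL (Fin 2) ℤ) : Matrix (Fin 2) (Fin 2) ℤ), ?_, ?_, ?_, ?_⟩
  · rw [← Matrix.GeneralLinearGroup.val_det_apply]; exact Units.isUnit _
  · intro h1
    apply hγ1; apply gl2zGL_ext
    rw [coe_coe_eq_map_intGL, h1]; simp
  · intro h1
    apply hγ2; apply gl2zGL_ext
    rw [coe_coe_eq_map_intGL, h1, coe_coe_negOne, map_cast_neg_one]
  · have : γ • x = x := hγ
    rwa [gl2z_smul_def] at this

/-! ## The orbit sum: from `Λ_irr` to the class count -/

section Measure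

variable [MeasurableSpace (Matrix (Fin 2) (Fin 2) ℝ)] [BorelSpace (Matrix (Fin 2) (Fin 2) ℝ)]

omit [MeasurableSpace (Matrix (Fin 2) (Fin 2) ℝ)] [BorelSpace (Matrix (Fin 2) (Fin 2) ℝ)] in
/-- Irreducible forms are a `Γ`-invariant set. [folklore] -/
theorem smul_mem_irr (γ : gl2zGL) (x : BinaryQuartic ℤ) (hx : x ∈ {x : BinaryQuartic ℤ | x.IsIrreducible}) :
    γ • x ∈ {x : BinaryQuartic ℤ | x.IsIrreducible} := by
  rw [Set.mem_setOf_eq, gl2z_smul_def]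
  refine IsIrreducible.subst_of_isUnit hx ?_
  rw [← Matrix.GeneralLinearGroup.val_det_apply]; exact Units.isUnit _

/-- **The weight of an orbit of irreducible forms**: with `𝓛 = 𝓛_X` a section set representing
exactly the irreducible forms of `S` of height `< X`, and `|Stab_{SL₂^±(ℝ)}(ℓ)| = n` on `𝓛`, the
orbit `O = Γ x₀` has weight `w(O) = n μ(G₀)/|Stab_Γ(x₀)|` if `x₀ ∈ S`, `H(x₀) < X`, and `0`
otherwise. [cite: BhargavaShankarAnnals2015, §2.3 (eq. (7); arXiv:1006.1002v2 numbering)] -/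
theorem orbitWeight_eq {K : ℕ} (D : Fin K → Piece) {X : ℝ} (h𝓛 : IsSectionSet (sections D X)) {S : Set (BinaryQuartic ℤ)}
    (hrepr : ∀ x : BinaryQuartic ℤ, x.IsIrreducible →
      ((∃ ℓ₀ ∈ sections D X, ∃ g₀ : Matrix (Fin 2) (Fin 2) ℝ, (g₀.det = 1 ∨ g₀.det = -1) ∧
        x.map (Int.castRingHom ℝ) = ℓ₀.subst g₀) ↔ (x ∈ S ∧ x.height < X)))
    {nst : ℕ} (hnst : ∀ ℓ ∈ sections D X, (substStabilizer ℓ).ncard = nst)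
    {x₀ : BinaryQuartic ℤ} (hx₀ : x₀.IsIrreducible) :
    (x₀ ∈ S ∧ x₀.height < X →
      orbitWeight (sections D X) (gl2zOrbit x₀) =
        (nst : ℝ≥0∞) * haarSL2pm G0 / (((MulAction.stabilizer gl2zGL x₀ : Set gl2zGL)).ncard : ℝ≥0∞)) ∧
    (¬ (x₀ ∈ S ∧ x₀.height < X) → orbitWeight (sections D X) (gl2zOrbit x₀) = 0) := by
  have hkey := encard_stabilizer_mul_orbitWeight h𝓛 x₀
  have hfin := finite_stabilizer hx₀
  have hk2 := two_le_ncard_stabilizer hx₀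
  rw [← hfin.cast_ncard_eq] at hkey
  set k := ((MulAction.stabilizer gl2zGL x₀ : Set gl2zGL)).ncard with hk
  have hk0 : (k : ℝ≥0∞) ≠ 0 := by
    have : (0 : ℕ) < k := by omega
    exact_mod_cast this.ne'
  have hcoe : (((k : ℕ) : ℕ∞) : ℝ≥0∞) = (k : ℝ≥0∞) := rfl
  rw [hcoe] at hkey
  constructor
  · intro hS
    obtain ⟨ℓ₀, hℓ₀, g₀, hg₀, hxe⟩ := (hrepr x₀ hx₀).2 hS
    rw [measure_Eset_eq h𝓛 hℓ₀ hg₀ hxe, hnst ℓ₀ hℓ₀] at hkey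
    rw [ENNReal.eq_div_iff hk0 (ENNReal.natCast_ne_top k), hkey]
  · intro hS
    have hnot : ¬ ∃ ℓ ∈ sections D X, ∃ g : Matrix (Fin 2) (Fin 2) ℝ, (g.det = 1 ∨ g.det = -1) ∧
        x₀.map (Int.castRingHom ℝ) = ℓ.subst g := fun h => hS ((hrepr x₀ hx₀).1 h)
    rw [Eset_eq_empty hnot, measure_empty, mul_eq_zero] at hkey
    exact hkey.resolve_left hk0

/-- **From the averaging integral to the class count** (Bhargava–Shankar §2.3, eq. (7) with the
weights `1/|Stab|`): with `N = N(S; X)`, `Λ = Λ_irr(X)`, `n = |Stab_{SL₂^±(ℝ)}|` on the sections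
and `μ₀ = μ(G₀)`, `2Λ/(n μ₀) ≤ N ≤ 2Λ/(n μ₀) + #{orbits with a stabilizer element ≠ ±1}`, the
latter `≤ 32500 X^{2/3}`. [cite: BhargavaShankarAnnals2015, §2.3 (eqs. (5)–(7)) and Lemma 2.4 (arXiv:1006.1002v2 numbering)] -/
theorem classCount_bounds {K : ℕ} (D : Fin K → Piece) {X : ℝ} (hX : 1 ≤ X) (h𝓛 : IsSectionSet (sections D X))
    {S : Set (BinaryQuartic ℤ)}
    (hrepr : ∀ x : BinaryQuartic ℤ, x.IsIrreducible →
      ((∃ ℓ₀ ∈ sections D X, ∃ g₀ : Matrix (Fin 2) (Fin 2) ℝ, (g₀.det = 1 ∨ g₀.det = -1) ∧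
        x.map (Int.castRingHom ℝ) = ℓ₀.subst g₀) ↔ (x ∈ S ∧ x.height < X)))
    {nst : ℕ} (hnst0 : 0 < nst) (hnst : ∀ ℓ ∈ sections D X, (substStabilizer ℓ).ncard = nst) :
    2 * (LamIrr D X).toReal / (nst * (haarSL2pm G0).toReal) ≤ gl2zClassCount S X ∧
    (gl2zClassCount S X : ℝ) ≤ 2 * (LamIrr D X).toReal / (nst * (haarSL2pm G0).toReal) + 32500 * X ^ (2 / 3 : ℝ) := by
  have hX0 : 0 < X := by linarith
  set 𝓛 := sections D X with h𝓛def
  set A : Set (Set (BinaryQuartic ℤ)) := gl2zOrbit '' {x : BinaryQuartic ℤ | x.IsIrreducible} with hA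
  set 𝒪 : Set (Set (BinaryQuartic ℤ)) := gl2zOrbit '' {x : BinaryQuartic ℤ | x ∈ S ∧ x.IsIrreducible ∧ x.height < X} with h𝒪
  have h𝒪fin : 𝒪.Finite := finite_gl2zOrbits_any S X
  have h𝒪A : 𝒪 ⊆ A := Set.image_mono fun x hx => hx.2.1
  have hμ0 := haarSL2pm_G0_pos
  have hμ0' : (haarSL2pm G0).toReal > 0 := ENNReal.toReal_pos hμ0.ne' haarSL2pm_G0_ne_top
  set c : ℝ := nst * (haarSL2pm G0).toReal with hc
  have hc0 : 0 < c := mul_pos (by exact_mod_cast hnst0) hμ0'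
  -- the weights
  set w : Set (BinaryQuartic ℤ) → ℝ≥0∞ := orbitWeight 𝓛 with hw
  -- `Λ = ∑' O : A, w O = ∑ O ∈ 𝒪, w O`
  have hΛ : LamIrr D X = ∑ O ∈ h𝒪fin.toFinset, w O := by
    rw [LamIrr, lintegral_countFn_eq_tsum_orbits h𝓛 smul_mem_irr, tsum_subtype A w,
      tsum_eq_sum (s := h𝒪fin.toFinset) ?_]
    · refine Finset.sum_congr rfl fun O hO => ?_
      exact Set.indicator_of_mem (h𝒪A ((Set.Finite.mem_toFinset h𝒪fin).1 hO)) w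
    · intro O hO
      rw [Set.Finite.mem_toFinset] at hO
      by_cases hOA : O ∈ A
      · rw [Set.indicator_of_mem hOA]
        obtain ⟨x₀, hx₀, rfl⟩ := hOA
        refine (orbitWeight_eq D h𝓛 hrepr hnst hx₀).2 fun hS => hO ?_
        exact ⟨x₀, ⟨hS.1, hx₀, hS.2⟩, rfl⟩
      · rw [Set.indicator_of_notMem hOA]
  -- each `O ∈ 𝒪`: `w O = c / k_O`, `k_O ≥ 2`, and `k_O ≠ 2` only for big-stabilizer orbits
  have hgen : ∀ O ∈ h𝒪fin.toFinset, ∃ x₀ : BinaryQuartic ℤ, x₀ ∈ S ∧ x₀.IsIrreducible ∧ x₀.height < X ∧ O = gl2zOrbit x₀ := by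
    intro O hO
    rw [Set.Finite.mem_toFinset] at hO
    obtain ⟨x₀, hx₀, rfl⟩ := hO
    exact ⟨x₀, hx₀.1, hx₀.2.1, hx₀.2.2, rfl⟩
  have hwval : ∀ O ∈ h𝒪fin.toFinset, ∃ k : ℕ, 2 ≤ k ∧ (w O).toReal = c / k ∧
      (2 < k → O ∈ gl2zOrbit '' {f : BinaryQuartic ℤ | f.disc ≠ 0 ∧ f.height < X ∧
        ∃ γ : Matrix (Fin 2) (Fin 2) ℤ, IsUnit γ.det ∧ γ ≠ 1 ∧ γ ≠ -1 ∧ f.subst γ = f}) := by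
    intro O hO
    obtain ⟨x₀, hxS, hxirr, hxH, rfl⟩ := hgen O hO
    set k := ((MulAction.stabilizer gl2zGL x₀ : Set gl2zGL)).ncard with hk
    refine ⟨k, two_le_ncard_stabilizer hxirr, ?_, fun hk2 => ?_⟩
    · have := (orbitWeight_eq D h𝓛 hrepr hnst hxirr).1 ⟨hxS, hxH⟩
      rw [hw, this, ENNReal.toReal_div, ENNReal.toReal_mul, ENNReal.toReal_natCast, ENNReal.toReal_natCast]
    · obtain ⟨γ, hγ, h1, h2, hfix⟩ := exists_subst_eq_of_two_lt hxirr hk2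
      exact ⟨x₀, ⟨disc_ne_zero_of_isIrreducible hxirr, hxH, γ, hγ, h1, h2, hfix⟩, rfl⟩
  -- the class count is the cardinality of `𝒪`
  have hN : (gl2zClassCount S X : ℝ) = (h𝒪fin.toFinset.card : ℝ) := by
    rw [gl2zClassCount, ← h𝒪, Set.ncard_eq_toFinset_card _ h𝒪fin]
  -- finiteness of the weights and `Λ.toReal = ∑ (w O).toReal`
  have hwfin : ∀ O ∈ h𝒪fin.toFinset, w O ≠ ⊤ := by
    intro O hO
    obtain ⟨k, hk2, hval, -⟩ := hwval O hO
    intro htop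
    rw [htop, ENNReal.toReal_top] at hval
    have : (0 : ℝ) < c / k := div_pos hc0 (by exact_mod_cast (by omega : 0 < k))
    linarith
  have hΛr : (LamIrr D X).toReal = ∑ O ∈ h𝒪fin.toFinset, (w O).toReal := by
    rw [hΛ, ENNReal.toReal_sum hwfin]
  -- upper bound for `Λ`: `∑ (w O).toReal ≤ (c/2) N`
  have hup : (LamIrr D X).toReal ≤ c / 2 * h𝒪fin.toFinset.card := by
    rw [hΛr]
    calc ∑ O ∈ h𝒪fin.toFinset, (w O).toReal ≤ ∑ _O ∈ h𝒪fin.toFinset, c / 2 := by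
          refine Finset.sum_le_sum fun O hO => ?_
          obtain ⟨k, hk2, hval, -⟩ := hwval O hO
          rw [hval]
          exact div_le_div_of_nonneg_left hc0.le (by norm_num) (by exact_mod_cast hk2)
      _ = c / 2 * h𝒪fin.toFinset.card := by rw [Finset.sum_const, nsmul_eq_mul]; ring
  -- lower bound: the orbits with `k = 2` contribute `c/2` each
  set Big : Set (Set (BinaryQuartic ℤ)) := gl2zOrbit '' {f : BinaryQuartic ℤ | f.disc ≠ 0 ∧ f.height < X ∧
        ∃ γ : Matrix (Fin 2) (Fin 2) ℤ, IsUnit γ.det ∧ γ ≠ 1 ∧ γ ≠ -1 ∧ f.subst γ = f} with hBig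
  have hBigbd := ncard_bigStab_orbits_le hX
  rw [← hBig] at hBigbd
  classical
  have hlo : c / 2 * ((h𝒪fin.toFinset.filter fun O => O ∉ Big).card : ℝ) ≤ (LamIrr D X).toReal := by
    rw [hΛr]
    calc c / 2 * ((h𝒪fin.toFinset.filter fun O => O ∉ Big).card : ℝ)
        = ∑ _O ∈ h𝒪fin.toFinset.filter (fun O => O ∉ Big), c / 2 := by rw [Finset.sum_const, nsmul_eq_mul]; ring
      _ = ∑ O ∈ h𝒪fin.toFinset.filter (fun O => O ∉ Big), (w O).toReal := by
          refine Finset.sum_congr rfl fun O hO => ?_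
          rw [Finset.mem_filter] at hO
          obtain ⟨k, hk2, hval, hbig⟩ := hwval O hO.1
          have hk : k = 2 := by
            by_contra hne
            exact hO.2 (hbig (by omega))
          rw [hval, hk]; norm_num
      _ ≤ ∑ O ∈ h𝒪fin.toFinset, (w O).toReal :=
          Finset.sum_le_sum_of_subset_of_nonneg (Finset.filter_subset _ _) fun O _ _ => ENNReal.toReal_nonneg
  -- the filtered set is large: `card 𝒪 ≤ card (filter) + ncard Big`
  -- `Big` is finite: every such orbit meets one of the three finite fixed families of
  -- `BhargavaShankarBigStabilizers` (this is also `finite_bigStab_orbits` of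
  -- `BhargavaShankarCongruenceOrbitBoundProofs.lean`; inlined to keep the import graph small)
  have hBigfin : Big.Finite := by
    rw [hBig]
    have hX0' : (0 : ℝ) ≤ X := by linarith
    obtain ⟨Y, hYdef⟩ : ∃ Y : ℝ, Y = X ^ (1 / 6 : ℝ) := ⟨_, rfl⟩
    have hY1 : 1 ≤ Y := hYdef ▸ Real.one_le_rpow hX (by norm_num)
    have hY6 : Y ^ 6 = X := by rw [hYdef, ← Real.rpow_natCast, ← Real.rpow_mul hX0']; norm_num
    obtain ⟨hfin1, -⟩ := ncard_fix1_le hY1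
    obtain ⟨hfin2, -⟩ := ncard_fix2_le hY1
    obtain ⟨hfinS, -⟩ := ncard_fixS_le hY1
    refine (((hfin1.union hfin2).union hfinS).image gl2zOrbit).subset ?_
    rintro _ ⟨f, ⟨hΔ, hH, γ, hγ, h1, h2, hfix⟩, rfl⟩
    obtain ⟨f', hequiv, hf'⟩ := exists_equiv_fixed_normal hΔ hγ h1 h2 hfix
    obtain ⟨δ, hδ, rfl⟩ := hequiv
    have hΔ' : (f.subst δ).disc ≠ 0 := by
      rw [disc_subst]; exact mul_ne_zero (pow_ne_zero _ hδ.ne_zero) hΔ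
    have hH' : (f.subst δ).height < Y ^ 6 := by rw [height_subst_of_isUnit f hδ, hY6]; exact hH
    refine ⟨f.subst δ, ?_, (gl2zOrbit_eq_of_equiv ⟨δ, hδ, rfl⟩).symm⟩
    rcases hf' with h | h | h
    · obtain ⟨hb, hd⟩ := bd_of_subst_γ₁ h
      exact Or.inl (Or.inl ⟨hb, hd, hΔ', hH'⟩)
    · exact Or.inl (Or.inr ⟨h, hΔ', hH'⟩)
    · obtain ⟨he, hd⟩ := ae_of_subst_S h
      exact Or.inr ⟨he, hd, hH'⟩
  have hsplit : (h𝒪fin.toFinset.card : ℝ) ≤ ((h𝒪fin.toFinset.filter fun O => O ∉ Big).card : ℝ) + Big.ncard := by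
    have h1 : h𝒪fin.toFinset.card ≤ (h𝒪fin.toFinset.filter fun O => O ∉ Big).card +
        (h𝒪fin.toFinset.filter fun O => O ∈ Big).card := by
      rw [add_comm, Finset.card_filter_add_card_filter_not]
    have h2 : (h𝒪fin.toFinset.filter fun O => O ∈ Big).card ≤ Big.ncard := by
      rw [Set.ncard_eq_toFinset_card _ hBigfin]
      refine Finset.card_le_card fun O hO => ?_
      rw [Finset.mem_filter] at hO
      rw [Set.Finite.mem_toFinset]; exact hO.2
    exact_mod_cast h1.trans (Nat.add_le_add_left h2 _)
  rw [hN]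
  constructor
  · rw [div_le_iff₀ hc0]; nlinarith [hup]
  · have h3 : c / 2 * (h𝒪fin.toFinset.card : ℝ) ≤ (LamIrr D X).toReal + c / 2 * Big.ncard := by nlinarith [hlo, hsplit, hc0]
    have h4 : (h𝒪fin.toFinset.card : ℝ) ≤ 2 * (LamIrr D X).toReal / c + Big.ncard := by
      rw [div_add' _ _ _ hc0.ne', le_div_iff₀ hc0]; nlinarith [h3]
    linarith [hBigbd]

/-! ## The constants: real stabilizer sizes, volumes, and the reducible bound -/

omit [MeasurableSpace (Matrix (Fin 2) (Fin 2) ℝ)] [BorelSpace (Matrix (Fin 2) (Fin 2) ℝ)] in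
/-- `|Stab_{SL₂^±(ℝ)}| = 8` on the type-`0` sections. [cite: BhargavaShankarAnnals2015, Lemma 2.2 (arXiv:1006.1002v2 numbering)] -/
theorem nst_data0 {X : ℝ} : ∀ ℓ ∈ sections data0 X, (substStabilizer ℓ).ncard = 8 := by
  rintro ℓ ⟨k, m, τ, hm, -, hτ, rfl⟩
  fin_cases k
  simp only [data0, piece0, Fin.zero_eta, Fin.isValue, Matrix.cons_val_zero] at hτ ⊢
  apply ncard_substStabilizer_of_disc_pos
  rw [disc_smul_real, disc_curve0]
  have : τ ^ 2 < 4 := by nlinarith [hτ.1, hτ.2]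
  have : 0 < (4 - τ ^ 2) / 27 := by linarith
  positivity

omit [MeasurableSpace (Matrix (Fin 2) (Fin 2) ℝ)] [BorelSpace (Matrix (Fin 2) (Fin 2) ℝ)] in
/-- `|Stab_{SL₂^±(ℝ)}| = 4` on the type-`1` sections. [cite: BhargavaShankarAnnals2015, Lemma 2.2 (arXiv:1006.1002v2 numbering)] -/
theorem nst_data1 {X : ℝ} : ∀ ℓ ∈ sections data1 X, (substStabilizer ℓ).ncard = 4 := by
  rintro ℓ ⟨k, m, τ, hm, -, hτ, rfl⟩
  apply ncard_substStabilizer_of_disc_neg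
  rw [disc_smul_real]
  have hm6 : 0 < m ^ 6 := by positivity
  fin_cases k <;>
    simp only [data1, piece1B, piece1C, piece1D, Fin.zero_eta, Fin.mk_one, Fin.reduceFinMk, Fin.isValue,
      Matrix.cons_val_zero, Matrix.cons_val_one, Matrix.cons_val] at hτ ⊢
  · rw [disc_curve1B]
    exact mul_neg_of_pos_of_neg hm6 (by nlinarith [sq_nonneg τ])
  · rw [disc_curve1C]
    have := cube_lt_one hτ.2
    exact mul_neg_of_pos_of_neg hm6 (by linarith)
  · rw [disc_curve1D]
    have := cube_lt_one hτ.2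
    exact mul_neg_of_pos_of_neg hm6 (by linarith)

omit [MeasurableSpace (Matrix (Fin 2) (Fin 2) ℝ)] [BorelSpace (Matrix (Fin 2) (Fin 2) ℝ)] in
/-- `|Stab_{SL₂^±(ℝ)}| = 8` on the type-`2+` sections. [cite: BhargavaShankarAnnals2015, Lemma 2.2 (arXiv:1006.1002v2 numbering)] -/
theorem nst_data2 {X : ℝ} : ∀ ℓ ∈ sections data2 X, (substStabilizer ℓ).ncard = 8 := by
  rintro ℓ ⟨k, m, s, hm, -, hs, rfl⟩
  fin_cases k
  simp only [data2, piece2, Fin.zero_eta, Fin.isValue, Matrix.cons_val_zero] at hs ⊢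
  apply ncard_substStabilizer_of_disc_pos
  rw [disc_smul_real]
  exact mul_pos (by positivity) (disc_curve2_pos hs)

omit [MeasurableSpace (Matrix (Fin 2) (Fin 2) ℝ)] [BorelSpace (Matrix (Fin 2) (Fin 2) ℝ)] in
/-- `vol(B₁) = (1/27) μ(G₀) · 8/5` for type `0`. [folklore] -/
theorem volume_real_B1set_data0 : volume.real (B1set data0) = 1 / 27 * boxHaar * (8 / 5) := by
  have e : B1set data0 = psi curve0.cone '' paramBox (Set.Ioo (-2) 2) := by
    rw [B1set]; ext v; simp [data0, piece0]
  rw [Measure.real, e, volume_image_psi_cone0, ENNReal.toReal_ofReal]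
  have := boxHaar_pos; positivity

omit [MeasurableSpace (Matrix (Fin 2) (Fin 2) ℝ)] [BorelSpace (Matrix (Fin 2) (Fin 2) ℝ)] in
/-- `vol(B₁) = (1/27) μ(G₀) · 8/5` for type `2+`. [folklore] -/
theorem volume_real_B1set_data2 : volume.real (B1set data2) = 1 / 27 * boxHaar * (8 / 5) := by
  have e : B1set data2 = psi curve2.cone '' paramBox (Set.Ioo (-2) 2) := by
    rw [B1set]; ext v; simp [data2, piece2]
  rw [Measure.real, e, volume_image_psi_cone2, ENNReal.toReal_ofReal]
  have := boxHaar_pos; positivity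

omit [MeasurableSpace (Matrix (Fin 2) (Fin 2) ℝ)] [BorelSpace (Matrix (Fin 2) (Fin 2) ℝ)] in
/-- Images of two pieces with separated invariants are disjoint. [folklore] -/
theorem disjoint_psi_images {C C' : SmoothCurve} {T T' : Set ℝ}
    (hsep : ∀ m m' τ τ' : ℝ, 0 < m → 0 < m' → τ ∈ T → τ' ∈ T' →
      ¬ ((m • C.c τ).I = (m' • C'.c τ').I ∧ (m • C.c τ).J = (m' • C'.c τ').J)) :
    Disjoint (psi C.cone '' paramBox T) (psi C'.cone '' paramBox T') := by
  rw [Set.disjoint_left]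
  rintro _ ⟨p, hp, rfl⟩ ⟨p', hp', heq⟩
  obtain ⟨-, h1, -, h3, h4⟩ := mem_paramBox_iff.1 hp
  obtain ⟨-, h1', -, h3', h4'⟩ := mem_paramBox_iff.1 hp'
  have hy : 0 < p 1 := paramBox_subset _ hp
  have hy' : 0 < p' 1 := paramBox_subset _ hp'
  have hforms : (p' 3 • C'.c (p' 4)).subst (iwasawaG (p' 0) (p' 1) (p' 2)) =
      (p 3 • C.c (p 4)).subst (iwasawaG (p 0) (p 1) (p 2)) := coeffs_injective heq
  have hI := congrArg BinaryQuartic.I hforms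
  have hJ := congrArg BinaryQuartic.J hforms
  rw [I_subst_of_det (Or.inl (det_iwasawaG hy' _)), I_subst_of_det (Or.inl (det_iwasawaG hy _))] at hI
  rw [J_subst_of_det (Or.inl (det_iwasawaG hy' _)), J_subst_of_det (Or.inl (det_iwasawaG hy _))] at hJ
  exact hsep _ _ _ _ h3.1 h3'.1 h4 h4' ⟨hI.symm, hJ.symm⟩

omit [MeasurableSpace (Matrix (Fin 2) (Fin 2) ℝ)] [BorelSpace (Matrix (Fin 2) (Fin 2) ℝ)] in
/-- `vol(B₁) = (1/27) μ(G₀) · 32/5` for type `1` (the three pieces have disjoint images).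
[folklore] -/
theorem volume_real_B1set_data1 : volume.real (B1set data1) = 1 / 27 * boxHaar * (32 / 5) := by
  have e : B1set data1 = (psi curve1B.cone '' paramBox (Set.Icc (-2) 2) ∪ psi curve1C.cone '' paramBox (Set.Ioo (-1) 1)) ∪
      psi curve1D.cone '' paramBox (Set.Ioo (-1) 1) := by
    rw [B1set]; ext v
    simp only [Set.mem_iUnion, Set.mem_union]
    constructor
    · rintro ⟨i, hi⟩
      fin_cases i
      · left; left; simpa [data1, piece1B] using hi
      · left; right; simpa [data1, piece1C] using hi
      · right; simpa [data1, piece1D] using hi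
    · rintro ((h | h) | h)
      · exact ⟨0, by simpa [data1, piece1B] using h⟩
      · exact ⟨1, by simpa [data1, piece1C] using h⟩
      · exact ⟨2, by simpa [data1, piece1D] using h⟩
  have hBC : Disjoint (psi curve1B.cone '' paramBox (Set.Icc (-2) 2)) (psi curve1C.cone '' paramBox (Set.Ioo (-1) 1)) := by
    refine disjoint_psi_images fun m m' τ τ' hm hm' hτ hτ' ⟨hI, hJ⟩ => ?_
    have h1 := cone1B_invariants m (τ := τ) hτ
    have h2 := (cone1C_invariants hm' (τ := τ') hτ').1
    rw [hI, hJ] at h1; linarith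
  have hBD : Disjoint (psi curve1B.cone '' paramBox (Set.Icc (-2) 2)) (psi curve1D.cone '' paramBox (Set.Ioo (-1) 1)) := by
    refine disjoint_psi_images fun m m' τ τ' hm hm' hτ hτ' ⟨hI, hJ⟩ => ?_
    have h1 := cone1B_invariants m (τ := τ) hτ
    have h2 := (cone1D_invariants hm' (τ := τ') hτ').1
    rw [hI, hJ] at h1; linarith
  have hCD : Disjoint (psi curve1C.cone '' paramBox (Set.Ioo (-1) 1)) (psi curve1D.cone '' paramBox (Set.Ioo (-1) 1)) := by
    refine disjoint_psi_images fun m m' τ τ' hm hm' hτ hτ' ⟨hI, hJ⟩ => ?_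
    have h1 := (cone1C_invariants hm (τ := τ) hτ).2
    have h2 := (cone1D_invariants hm' (τ := τ') hτ').2
    rw [hJ] at h1; linarith
  have hmC : MeasurableSet (psi curve1C.cone '' paramBox (Set.Ioo (-1) 1)) := measurableSet_psi_image piece1C
  have hmD : MeasurableSet (psi curve1D.cone '' paramBox (Set.Ioo (-1) 1)) := measurableSet_psi_image piece1D
  rw [Measure.real, e, measure_union (Disjoint.union_left hBD hCD) hmD, measure_union hBC hmC,
    volume_image_psi_cone1B, volume_image_psi_cone1C, volume_image_psi_cone1D]
  have hb := boxHaar_pos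
  rw [ENNReal.toReal_add (by exact ENNReal.add_ne_top.2 ⟨ENNReal.ofReal_ne_top, ENNReal.ofReal_ne_top⟩) ENNReal.ofReal_ne_top,
    ENNReal.toReal_add ENNReal.ofReal_ne_top ENNReal.ofReal_ne_top,
    ENNReal.toReal_ofReal (by positivity), ENNReal.toReal_ofReal (by positivity)]
  ring

omit [MeasurableSpace (Matrix (Fin 2) (Fin 2) ℝ)] [BorelSpace (Matrix (Fin 2) (Fin 2) ℝ)] in
/-- **The uniform reducible bound in the main body** (Lemma 2.3 in box form, made uniform in
`y ≥ √3/2`): with `R = X^{1/6}` and `K = K_ε` of `ncard_reducible_realBox_le`, the reducible forms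
with `e ≠ 0` counted at any `g` of the main body are `≤ 32 K (2(C₁R)²)^ε (C₁R)⁴`.
[cite: BhargavaShankarAnnals2015, Lemma 2.3 (arXiv:1006.1002v2 numbering)] -/
theorem reducible_uniform_bound {ε K : ℝ} (hK0 : 0 < K)
    (hK : ∀ A B C D E : ℝ, 1 ≤ A → 1 ≤ B → 1 ≤ C → 1 ≤ D → 1 ≤ E →
      ({f : BinaryQuartic ℤ | f.a ≠ 0 ∧ ¬ f.IsIrreducible ∧ |(f.a : ℝ)| ≤ A ∧ |(f.b : ℝ)| ≤ B ∧
            |(f.c : ℝ)| ≤ C ∧ |(f.d : ℝ)| ≤ D ∧ |(f.e : ℝ)| ≤ E}.ncard : ℝ) ≤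
        K * (A * E) ^ ε * (A * B * C * D + A * B * D * E + A * B * C * E))
    {k : ℕ} (D : Fin k → Piece) {X : ℝ} (hX : 1 ≤ X) :
    ∀ x y θ : ℝ, |x| ≤ 1 / 2 → Real.sqrt 3 / 2 ≤ y → 1 ≤ C₁ * X ^ (1 / 6 : ℝ) * (y⁻¹) ^ 2 →
      (({f : BinaryQuartic ℤ | (f.map (Int.castRingHom ℝ)).coeffs ∈ regionS (sections D X) (iwasawaGinv x y θ) ∧
        f.e ≠ 0 ∧ ¬ f.IsIrreducible}).ncard : ℝ) ≤
        32 * K * (2 * (C₁ * X ^ (1 / 6 : ℝ)) ^ 2) ^ ε * (C₁ * X ^ (1 / 6 : ℝ)) ^ 4 := by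
  intro x y θ hx hy hbody
  have hX0 : 0 < X := by linarith
  set R := X ^ (1 / 6 : ℝ) with hRdef
  have hR : 0 ≤ R := Real.rpow_nonneg hX0.le _
  have hy0 : 0 < y := lt_of_lt_of_le (by positivity) hy
  obtain ⟨-, h⟩ := ncard_reducible_e_ne_zero_le hK hR (fun ℓ hℓ l => sections_coeff_le D hX0.le hℓ l) hx hy hbody (θ := θ)
  refine h.trans ?_
  have hCR : 0 ≤ C₁ * R := mul_nonneg C₁_pos.le hR
  -- `A E = 2 (C₁R)²`
  have e1 : C₁ * R * (y⁻¹) ^ 2 * (2 * (C₁ * R * y ^ 2)) = 2 * (C₁ * R) ^ 2 := by field_simp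
  rw [e1]
  -- the bracket `≤ 32 (C₁R)⁴`
  obtain ⟨p1, p2, -, -⟩ := pow_bounds_of_ge hy
  have hyi : y⁻¹ ≤ 3 / 2 := by rw [inv_le_comm₀ hy0 (by norm_num)]; linarith
  have hyi2 : (y⁻¹) ^ 2 ≤ 3 / 2 := by
    rw [inv_pow, inv_le_comm₀ (by positivity) (by norm_num)]; linarith
  have e2 : C₁ * R * (y⁻¹) ^ 2 * (2 * (C₁ * R * y⁻¹)) * (2 * (C₁ * R)) * (2 * (C₁ * R * y)) +
      C₁ * R * (y⁻¹) ^ 2 * (2 * (C₁ * R * y⁻¹)) * (2 * (C₁ * R * y)) * (2 * (C₁ * R * y ^ 2)) +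
      C₁ * R * (y⁻¹) ^ 2 * (2 * (C₁ * R * y⁻¹)) * (2 * (C₁ * R)) * (2 * (C₁ * R * y ^ 2)) =
      8 * (C₁ * R) ^ 4 * ((y⁻¹) ^ 2 + 1 + y⁻¹) := by field_simp; ring
  rw [e2]
  have hbr : (y⁻¹) ^ 2 + 1 + y⁻¹ ≤ 4 := by linarith
  have hpow : 0 ≤ (2 * (C₁ * R) ^ 2) ^ ε := Real.rpow_nonneg (by positivity) _
  have : K * (2 * (C₁ * R) ^ 2) ^ ε * (8 * (C₁ * R) ^ 4 * ((y⁻¹) ^ 2 + 1 + y⁻¹)) ≤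
      K * (2 * (C₁ * R) ^ 2) ^ ε * (8 * (C₁ * R) ^ 4 * 4) := by
    apply mul_le_mul_of_nonneg_left _ (mul_nonneg hK0.le hpow)
    exact mul_le_mul_of_nonneg_left hbr (by positivity)
  refine this.trans (le_of_eq ?_)
  ring

/-! ## The asymptotic for one type -/

omit [MeasurableSpace (Matrix (Fin 2) (Fin 2) ℝ)] [BorelSpace (Matrix (Fin 2) (Fin 2) ℝ)] in
/-- Elementary: from the two-sided bounds to an absolute-value bound. [folklore] -/
theorem abs_sub_le_of_bounds {N Λr P c B T₁ T₂ : ℝ} (hc : 0 < c) (h1 : 2 * Λr / c ≤ N) (h2 : N ≤ 2 * Λr / c + B)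
    (h3 : Λr ≤ P + T₁) (h4 : P ≤ Λr + T₂) (hT : T₁ ≤ T₂) :
    |N - 2 * P / c| ≤ 2 / c * T₂ + B := by
  have hA : 2 * Λr / c ≤ 2 * P / c + 2 / c * T₂ := by
    rw [show 2 * P / c + 2 / c * T₂ = 2 * (P + T₂) / c by ring]
    exact div_le_div_of_nonneg_right (by nlinarith) hc.le
  have hB' : 2 * P / c ≤ 2 * Λr / c + 2 / c * T₂ := by
    rw [show 2 * Λr / c + 2 / c * T₂ = 2 * (Λr + T₂) / c by ring]
    exact div_le_div_of_nonneg_right (by nlinarith) hc.le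
  rw [abs_le]; constructor <;> nlinarith

omit [MeasurableSpace (Matrix (Fin 2) (Fin 2) ℝ)] [BorelSpace (Matrix (Fin 2) (Fin 2) ℝ)] in
/-- Powers of `R = X^{1/6} ≥ 1` against `X^{3/4+ε} = R^{9/2+6ε}`. [folklore] -/
theorem rpow_bookkeeping {X : ℝ} (hX : 1 ≤ X) {ε : ℝ} (hε : 0 < ε) :
    let R := X ^ (1 / 6 : ℝ)
    1 ≤ R ∧ R ^ 4 * Real.sqrt R ≤ X ^ (3 / 4 + ε) ∧ (R ^ 2) ^ ε * R ^ 4 ≤ X ^ (3 / 4 + ε) ∧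
      R ^ 5 / Real.sqrt R ≤ X ^ (3 / 4 + ε) ∧ R ^ 4 ≤ X ^ (3 / 4 + ε) ∧ X ^ (5 / 6 : ℝ) = R ^ 5 ∧ X ^ (2 / 3 : ℝ) = R ^ 4 := by
  intro R
  have hX0 : 0 < X := by linarith
  have hR1 : 1 ≤ R := Real.one_le_rpow hX (by norm_num)
  have hR0 : 0 < R := by linarith
  -- everything as real powers of `X`
  have eR : ∀ t : ℝ, R ^ t = X ^ (t / 6) := by
    intro t; rw [show (t / 6) = (1 / 6 : ℝ) * t by ring, Real.rpow_mul hX0.le]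
  have eRn : ∀ n : ℕ, R ^ n = X ^ ((n : ℝ) / 6) := by
    intro n; rw [← eR, Real.rpow_natCast]
  have esq : Real.sqrt R = X ^ ((1 : ℝ) / 12) := by
    rw [Real.sqrt_eq_rpow, eR]; norm_num
  have hmono : ∀ {a b : ℝ}, a ≤ b → X ^ a ≤ X ^ b := fun h => Real.rpow_le_rpow_of_exponent_le hX h
  refine ⟨hR1, ?_, ?_, ?_, ?_, ?_, ?_⟩
  · rw [eRn, esq, ← Real.rpow_add hX0]; exact hmono (by norm_num; linarith)
  · rw [← Real.rpow_natCast, ← Real.rpow_mul hR0.le, eR, eRn, ← Real.rpow_add hX0]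
    exact hmono (by push_cast; linarith)
  · rw [eRn, esq, ← Real.rpow_sub hX0]; exact hmono (by norm_num; linarith)
  · rw [eRn]; exact hmono (by norm_num; linarith)
  · rw [eRn]; norm_num
  · rw [eRn]; norm_num

set_option maxHeartbeats 800000 in
/-- **Theorem 2.1 for one type**: with the sections `𝓛_X` of the data `D` representing exactly the
irreducible forms of `S` of height `< X`, `|Stab_{SL₂^±(ℝ)}| = n` on them and `vol(B₁) = V`,
`N(S; X) = 2V(π²/3)/(n μ(G₀)) · X^{5/6} + O_ε(X^{3/4+ε})`. [cite: BhargavaShankarAnnals2015, Thm 2.1 and §2.3–2.4 (arXiv:1006.1002v2 numbering)] -/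
theorem type_asymptotic {K : ℕ} (D : Fin K → Piece) (S : Set (BinaryQuartic ℤ)) {nst : ℕ} (hnst0 : 0 < nst)
    (h𝓛 : ∀ X : ℝ, IsSectionSet (sections D X))
    (hrepr : ∀ X : ℝ, 0 < X → ∀ x : BinaryQuartic ℤ, x.IsIrreducible →
      ((∃ ℓ₀ ∈ sections D X, ∃ g₀ : Matrix (Fin 2) (Fin 2) ℝ, (g₀.det = 1 ∨ g₀.det = -1) ∧
        x.map (Int.castRingHom ℝ) = ℓ₀.subst g₀) ↔ (x ∈ S ∧ x.height < X)))
    (hnst : ∀ X : ℝ, ∀ ℓ ∈ sections D X, (substStabilizer ℓ).ncard = nst)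
    {V : ℝ} (hV : volume.real (B1set D) = V) :
    ∀ ε : ℝ, 0 < ε → ∃ C : ℝ, ∀ X : ℝ, 1 ≤ X →
      |(gl2zClassCount S X : ℝ) - 2 * V * (π ^ 2 / 3) / (nst * boxHaar) * X ^ (5 / 6 : ℝ)| ≤ C * X ^ (3 / 4 + ε) := by
  intro ε hε
  obtain ⟨Kr, hKr0, hKr⟩ := ncard_reducible_realBox_le hε
  have hV0 : 0 ≤ V := by rw [← hV]; exact ENNReal.toReal_nonneg
  have hb := boxHaar_pos
  have hC1 := C₁_pos
  have hLm := one_le_Lmax D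
  set c : ℝ := nst * boxHaar with hc
  have hc0 : 0 < c := by positivity
  -- the constants of the four error terms
  set a₂ : ℝ := (576000 * K * (20 * C₁ * Lmax D) ^ 4 + 256 * C₁ ^ 4) * Real.sqrt C₁ * π with ha₂
  set a₃ : ℝ := 32 * Kr * (2 * C₁ ^ 2) ^ ε * C₁ ^ 4 * (π ^ 2 / 3) with ha₃
  set a₄ : ℝ := V * π / Real.sqrt C₁ with ha₄
  have hLm0 : 0 ≤ Lmax D := by linarith
  have hsC : 0 < Real.sqrt C₁ := Real.sqrt_pos.2 hC1
  have ha₂nn : 0 ≤ a₂ := by positivity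
  have ha₃nn : 0 ≤ a₃ := by positivity
  have ha₄nn : 0 ≤ a₄ := by positivity
  refine ⟨2 / c * (a₂ + a₃ + a₄) + 32500, fun X hX => ?_⟩
  have hX0 : 0 < X := by linarith
  obtain ⟨hR1, b1, b2, b3, b4, e56, e23⟩ := rpow_bookkeeping hX hε
  set R := X ^ (1 / 6 : ℝ) with hRdef
  have hR0 : 0 < R := by linarith
  -- the reducible bound and the integral bounds
  set RedB : ℝ := 32 * Kr * (2 * (C₁ * R) ^ 2) ^ ε * (C₁ * R) ^ 4 with hRedB
  have hRedB0 : 0 ≤ RedB := by positivity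
  obtain ⟨hup, hlo⟩ := LamIrr_toReal_bounds D hX (h𝓛 X) hRedB0 (reducible_uniform_bound hKr0 hKr D hX)
  obtain ⟨hN1, hN2⟩ := classCount_bounds D hX (h𝓛 X) (hrepr X hX0) hnst0 (hnst X)
  rw [← boxHaar_eq] at hN1 hN2
  rw [haarSL2pm_gaussFD_toReal, hV] at hup hlo
  set M := X ^ (5 / 6 : ℝ) * V with hM
  set Λr := (LamIrr D X).toReal
  set E₁ := 576000 * K * Lam D X ^ 4 with hE₁
  set E₂ := 256 * (C₁ * R) ^ 4 with hE₂
  have hE₁0 : 0 ≤ E₁ := by have := Lam_pos D hX0; positivity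
  have hE₂0 : 0 ≤ E₂ := by positivity
  have hY := Y0_pos hX0
  have hY32 : 0 ≤ Y0 X - Real.sqrt 3 / 2 := by linarith [sqrt_three_div_two_le_Y0 hX]
  -- `T₁ ≤ T₂`
  set T₁ := E₁ * (Y0 X - Real.sqrt 3 / 2) * π with hT₁
  set T₂ := (E₁ + E₂) * (Y0 X - Real.sqrt 3 / 2) * π + RedB * (π ^ 2 / 3) + M * (π / Y0 X) with hT₂
  have hMnn : 0 ≤ M := by positivity
  have hT₁₂ : T₁ ≤ T₂ := by
    have : 0 ≤ E₂ * (Y0 X - Real.sqrt 3 / 2) * π := by positivity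
    have : 0 ≤ M * (π / Y0 X) := by positivity
    nlinarith [Real.pi_pos]
  have hlo' : M * (π ^ 2 / 3) ≤ Λr + T₂ := by rw [hT₂]; linarith
  have hup' : Λr ≤ M * (π ^ 2 / 3) + T₁ := by rw [hT₁]; linarith
  have habs := abs_sub_le_of_bounds hc0 hN1 hN2 (P := M * (π ^ 2 / 3)) hup' hlo' hT₁₂
  -- identify the main term
  have emain : 2 * (M * (π ^ 2 / 3)) / c = 2 * V * (π ^ 2 / 3) / (nst * boxHaar) * X ^ (5 / 6 : ℝ) := by
    rw [hM, hc]; ring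
  rw [emain] at habs
  refine habs.trans ?_
  -- bound `T₂ ≤ (a₂ + a₃ + a₄) X^{3/4+ε}`
  have hXe : 0 ≤ X ^ (3 / 4 + ε) := Real.rpow_nonneg hX0.le _
  have eLam : Lam D X = 20 * C₁ * Lmax D * R := rfl
  have eY : Y0 X = Real.sqrt C₁ * Real.sqrt R := by rw [Y0, ← hRdef, Real.sqrt_mul hC1.le]
  have hsR : 0 < Real.sqrt R := Real.sqrt_pos.2 hR0
  have t1 : (E₁ + E₂) * (Y0 X - Real.sqrt 3 / 2) * π ≤ a₂ * X ^ (3 / 4 + ε) := by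
    have s1 : (E₁ + E₂) * (Y0 X - Real.sqrt 3 / 2) * π ≤ (E₁ + E₂) * Y0 X * π := by
      have hd : 0 ≤ (E₁ + E₂) * (Real.sqrt 3 / 2) * π := by positivity
      linarith
    have s2 : (E₁ + E₂) * Y0 X * π = a₂ * (R ^ 4 * Real.sqrt R) := by
      rw [hE₁, hE₂, eLam, eY, ha₂]; ring
    have s3 : a₂ * (R ^ 4 * Real.sqrt R) ≤ a₂ * X ^ (3 / 4 + ε) := mul_le_mul_of_nonneg_left b1 ha₂nn
    linarith
  have t2 : RedB * (π ^ 2 / 3) ≤ a₃ * X ^ (3 / 4 + ε) := by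
    have e : RedB * (π ^ 2 / 3) = a₃ * ((R ^ 2) ^ ε * R ^ 4) := by
      have hm : (2 * (C₁ * R) ^ 2) ^ ε = (2 * C₁ ^ 2) ^ ε * (R ^ 2) ^ ε := by
        rw [show (2 * (C₁ * R) ^ 2) = (2 * C₁ ^ 2) * R ^ 2 by ring]
        exact Real.mul_rpow (by positivity) (by positivity)
      rw [hRedB, ha₃, hm]; ring
    have s3 : a₃ * ((R ^ 2) ^ ε * R ^ 4) ≤ a₃ * X ^ (3 / 4 + ε) := mul_le_mul_of_nonneg_left b2 ha₃nn
    linarith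
  have t3 : M * (π / Y0 X) ≤ a₄ * X ^ (3 / 4 + ε) := by
    have e : M * (π / Y0 X) = a₄ * (R ^ 5 / Real.sqrt R) := by
      rw [hM, e56, eY, ha₄]; field_simp
    have s3 : a₄ * (R ^ 5 / Real.sqrt R) ≤ a₄ * X ^ (3 / 4 + ε) := mul_le_mul_of_nonneg_left b3 ha₄nn
    linarith
  have t4 : (32500 : ℝ) * X ^ (2 / 3 : ℝ) ≤ 32500 * X ^ (3 / 4 + ε) := by
    rw [e23]; exact mul_le_mul_of_nonneg_left b4 (by norm_num)
  have hsum : T₂ ≤ (a₂ + a₃ + a₄) * X ^ (3 / 4 + ε) := by rw [hT₂]; nlinarith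
  calc 2 / c * T₂ + 32500 * X ^ (2 / 3 : ℝ) ≤ 2 / c * ((a₂ + a₃ + a₄) * X ^ (3 / 4 + ε)) + 32500 * X ^ (3 / 4 + ε) := by
        gcongr
    _ = (2 / c * (a₂ + a₃ + a₄) + 32500) * X ^ (3 / 4 + ε) := by ring

/-! ## Theorem 2.1 -/

/-- **Theorem 2.1, type `0`**: `N(V_ℤ^{(0)}; X) = (4/135) ζ(2) X^{5/6} + O_ε(X^{3/4+ε})`. [cite: BhargavaShankarAnnals2015, Thm 2.1 (a); arXiv:1006.1002v2 numbering] -/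
theorem classCount_fourRealRoots : ∀ ε : ℝ, 0 < ε → ∃ C : ℝ, ∀ X : ℝ, 1 ≤ X →
    |(gl2zClassCount fourRealRoots X : ℝ) - 4 / 135 * (π ^ 2 / 6) * X ^ (5 / 6 : ℝ)| ≤ C * X ^ (3 / 4 + ε) := by
  intro ε hε
  obtain ⟨C, hC⟩ := type_asymptotic data0 fourRealRoots (nst := 8) (by norm_num) isSectionSet_data0
    (fun X hX x hx => repr_iff_data0 (disc_ne_zero_of_isIrreducible hx) hX) (fun X => nst_data0) volume_real_B1set_data0 ε hε
  refine ⟨C, fun X hX => ?_⟩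
  have h := hC X hX
  have hb := boxHaar_pos
  have e : 2 * (1 / 27 * boxHaar * (8 / 5)) * (π ^ 2 / 3) / ((8 : ℕ) * boxHaar) = 4 / 135 * (π ^ 2 / 6) := by
    push_cast; field_simp; ring
  rwa [e] at h

/-- **Theorem 2.1, type `1`**: `N(V_ℤ^{(1)}; X) = (32/135) ζ(2) X^{5/6} + O_ε(X^{3/4+ε})`. [cite: BhargavaShankarAnnals2015, Thm 2.1 (b); arXiv:1006.1002v2 numbering] -/
theorem classCount_twoRealRoots : ∀ ε : ℝ, 0 < ε → ∃ C : ℝ, ∀ X : ℝ, 1 ≤ X →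
    |(gl2zClassCount twoRealRoots X : ℝ) - 32 / 135 * (π ^ 2 / 6) * X ^ (5 / 6 : ℝ)| ≤ C * X ^ (3 / 4 + ε) := by
  intro ε hε
  obtain ⟨C, hC⟩ := type_asymptotic data1 twoRealRoots (nst := 4) (by norm_num) isSectionSet_data1
    (fun X hX x _ => repr_iff_data1 hX) (fun X => nst_data1) volume_real_B1set_data1 ε hε
  refine ⟨C, fun X hX => ?_⟩
  have h := hC X hX
  have hb := boxHaar_pos
  have e : 2 * (1 / 27 * boxHaar * (32 / 5)) * (π ^ 2 / 3) / ((4 : ℕ) * boxHaar) = 32 / 135 * (π ^ 2 / 6) := by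
    push_cast; field_simp; ring
  rwa [e] at h

/-- **Theorem 2.1, type `2+`**: `N(V_ℤ^{(2+)}; X) = (4/135) ζ(2) X^{5/6} + O_ε(X^{3/4+ε})`. [cite: BhargavaShankarAnnals2015, Thm 2.1 (c) with §2.1 (V^{(2)} = V^{(2+)} ⊔ V^{(2−)}); arXiv:1006.1002v2 numbering] -/
theorem classCount_posDefinite : ∀ ε : ℝ, 0 < ε → ∃ C : ℝ, ∀ X : ℝ, 1 ≤ X →
    |(gl2zClassCount posDefinite X : ℝ) - 4 / 135 * (π ^ 2 / 6) * X ^ (5 / 6 : ℝ)| ≤ C * X ^ (3 / 4 + ε) := by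
  intro ε hε
  obtain ⟨C, hC⟩ := type_asymptotic data2 posDefinite (nst := 8) (by norm_num) isSectionSet_data2
    (fun X hX x hx => repr_iff_data2 (disc_ne_zero_of_isIrreducible hx) hX) (fun X => nst_data2) volume_real_B1set_data2 ε hε
  refine ⟨C, fun X hX => ?_⟩
  have h := hC X hX
  have hb := boxHaar_pos
  have e : 2 * (1 / 27 * boxHaar * (8 / 5)) * (π ^ 2 / 3) / ((8 : ℕ) * boxHaar) = 4 / 135 * (π ^ 2 / 6) := by
    push_cast; field_simp; ring
  rwa [e] at h

/-- **Theorem 2.1, type `2`**: `N(V_ℤ^{(2)}; X) = (8/135) ζ(2) X^{5/6} + O_ε(X^{3/4+ε})`, from the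
positive definite count by `f ↦ −f`. [cite: BhargavaShankarAnnals2015, Thm 2.1 (c); arXiv:1006.1002v2 numbering] -/
theorem classCount_noRealRoots : ∀ ε : ℝ, 0 < ε → ∃ C : ℝ, ∀ X : ℝ, 1 ≤ X →
    |(gl2zClassCount noRealRoots X : ℝ) - 8 / 135 * (π ^ 2 / 6) * X ^ (5 / 6 : ℝ)| ≤ C * X ^ (3 / 4 + ε) := by
  intro ε hε
  obtain ⟨C, hC⟩ := classCount_posDefinite ε hε
  refine ⟨2 * C, fun X hX => ?_⟩
  have h := hC X hX
  rw [gl2zClassCount_noRealRoots X]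
  push_cast
  have e : (2 : ℝ) * (gl2zClassCount posDefinite X : ℝ) - 8 / 135 * (π ^ 2 / 6) * X ^ (5 / 6 : ℝ) =
      2 * ((gl2zClassCount posDefinite X : ℝ) - 4 / 135 * (π ^ 2 / 6) * X ^ (5 / 6 : ℝ)) := by ring
  rw [e, abs_mul, abs_two]
  linarith

end Measure

/-- **Bhargava–Shankar, Theorem 2.1 (= Theorem 1.6), discharged**: the number of
`GL₂(ℤ)`-equivalence classes of irreducible integral binary quartic forms with four, two, resp. no
real roots and height `< X` is `(4/135) ζ(2) X^{5/6}`, `(32/135) ζ(2) X^{5/6}`,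
`(8/135) ζ(2) X^{5/6}` up to `O_ε(X^{3/4+ε})`, with `ζ(2) = π²/6`. The proof follows the
averaging method of §2 of the paper (Gauss's fundamental domain for `GL₂(ℤ)`, the thickened
fundamental sets `G₀ L`, unfolding with the weights `1/|Stab|`, the Jacobian `2/27`, cutting off the
cusp at `y ≍ X^{1/12}`, Lemma 2.3 for reducible forms), with Davenport's lemma replaced by a
Lipschitz cube count and Lemma 2.4 by an elementary fixed-subspace bound; it is carried out for the
Borel structure on `M₂(ℝ)`. [cite: BhargavaShankarAnnals2015, Thm 1.6 and Thm 2.1 (arXiv:1006.1002v2 numbering)] -/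
theorem _root_.Literature.NumberTheory.EllipticCurves.bhargavaShankar_classCount_holds :
    Literature.NumberTheory.EllipticCurves.bhargavaShankar_classCount := by
  letI : MeasurableSpace (Matrix (Fin 2) (Fin 2) ℝ) := borel _
  haveI : BorelSpace (Matrix (Fin 2) (Fin 2) ℝ) := ⟨rfl⟩
  intro ε hε
  obtain ⟨C₀, h₀⟩ := classCount_fourRealRoots ε hε
  obtain ⟨C₁', h₁⟩ := classCount_twoRealRoots ε hε
  obtain ⟨C₂, h₂⟩ := classCount_noRealRoots ε hε
  refine ⟨max C₀ (max C₁' C₂), fun X hX => ⟨?_, ?_, ?_⟩⟩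
  · have hXe : 0 ≤ X ^ (3 / 4 + ε) := Real.rpow_nonneg (by linarith) _
    exact (h₀ X hX).trans (mul_le_mul_of_nonneg_right (le_max_left _ _) hXe)
  · have hXe : 0 ≤ X ^ (3 / 4 + ε) := Real.rpow_nonneg (by linarith) _
    exact (h₁ X hX).trans (mul_le_mul_of_nonneg_right ((le_max_left _ _).trans (le_max_right _ _)) hXe)
  · have hXe : 0 ≤ X ^ (3 / 4 + ε) := Real.rpow_nonneg (by linarith) _
    exact (h₂ X hX).trans (mul_le_mul_of_nonneg_right ((le_max_right _ _).trans (le_max_right _ _)) hXe)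

end BinaryQuartic

end Literature.NumberTheory.EllipticCurves

end
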